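import Summits.Parity.GeneralizedHardyLittlewood.Theorems.BeyondDiagonalBeatsQuarter.OffDiagLevelFactorCell
import Mathlib.MeasureTheory.Measure.Haar.NormedSpace
import HarnessLib

/-!
# Route `PrimeLevelFamEdge`, crux K_B (stmt-Parity-20343), line `diagonal_kernel_split` rev 4, plan Ω,
# node **L7c, part 7 — the level-factor form on the UNIT box** (prover-6's D5 request: cells with different dyadic boxes
# `[K₁/2,2K₁]×[K₂/2,2K₂]` share ONE integration domain `τ ∈ [1/2,2]²` after `t = (K₁τ₁, K₂τ₂)`)

* `integral_integral_comp_mul_mul` — `∫dt₁∫dt₂ G(t₁,t₂) = K₁K₂·∫dτ₁∫dτ₂ G(K₁τ₁, K₂τ₂)` for `K₁, K₂ > 0`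
  (Mathlib `integral_comp_mul_left`, no integrability needed);
* **`sum_mul_fourier2_boxWeight_cell_eq_unitBox`** — the switched cell's level sum of `OffDiagLevelFactorCell` with the box
  integral rescaled to the unit box: `Σ_{q∈S} c_q·Φ̂_{q,…}(h₁/(q(r+1)), s/h₁ + A/(h₁q(r+1)))
  = K₁K₂·∫dτ₁∫dτ₂ K(K₁τ₁,K₂τ₂)·Σ_{q∈S} c_q Ψ_{(K₁τ₁,K₂τ₂)}(1/q)` with `K_j = 2^{i_j}`; the bumps become `θ(τ₁)θ(τ₂)`
  (support `τ_j ∈ [1/2, 2]` for every box), so the consumer's large-sieve bound is integrated over ONE `τ`-domain.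

Exact identities; helper; closes nothing; standard axioms. «The programme SEARCHES and TYPES; no claim about Landau–Siegel
zeros, Theorems 1–2 of arXiv:2211.02515 or a repaired Margin232 until a kernel theorem says so.»
-/

noncomputable section

open Finset Real Complex MeasureTheory
open scoped Nat

namespace Summit.Parity.GeneralizedHardyLittlewood.Theorems.BeyondDiagonalBeatsQuarter.LevelSeparation

open Literature.Analysis.FunctionSpaces (besselJ)
open Literature.Analysis.Calculus.WhitneyConvex (dyadicBump)
open Literature.NumberTheory.LFunctions.KMV2000 (cutoffW)
open Literature.NumberTheory.Sieve.FriedlanderIwaniecPrimes (fourier2 ker)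
open OffDiag (boxWeight)

/-- **Rescaling an iterated integral to the unit box**: for `K₁, K₂ > 0`,
`∫dt₁∫dt₂ G(t₁,t₂) = K₁K₂·∫dτ₁∫dτ₂ G(K₁τ₁, K₂τ₂)`. [folklore] -/
theorem integral_integral_comp_mul_mul (G : ℝ → ℝ → ℂ) {K₁ K₂ : ℝ} (hK₁ : 0 < K₁) (hK₂ : 0 < K₂) :
    ∫ t₁, ∫ t₂, G t₁ t₂ = (K₁ * K₂ : ℝ) • ∫ τ₁, ∫ τ₂, G (K₁ * τ₁) (K₂ * τ₂) := by
  have h2 : ∀ t₁ : ℝ, ∫ τ₂, G t₁ (K₂ * τ₂) = |K₂⁻¹| • ∫ t₂, G t₁ t₂ := fun t₁ =>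
    Measure.integral_comp_mul_left (fun t₂ => G t₁ t₂) K₂
  have h1 : ∫ τ₁, ∫ t₂, G (K₁ * τ₁) t₂ = |K₁⁻¹| • ∫ t₁, ∫ t₂, G t₁ t₂ :=
    Measure.integral_comp_mul_left (fun t₁ => ∫ t₂, G t₁ t₂) K₁
  simp_rw [h2, integral_smul, h1, smul_smul]
  rw [abs_of_pos (inv_pos.2 hK₁), abs_of_pos (inv_pos.2 hK₂)]
  rw [show (K₁ * K₂ : ℝ) * (K₂⁻¹ * K₁⁻¹) = 1 by field_simp, one_smul]

/-- **A switched cell's level sum in level-factor form on the UNIT box** (`K_j = 2^{i_j}`):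
`Σ_{q∈S} c_q·Φ̂_{q,d₁,d₂,l/d₁,m/d₂,r+1,i}(h₁/(q(r+1)), s/h₁ + A/(h₁q(r+1)))
  = (K₁K₂)·∫dτ₁∫dτ₂ K(K₁τ₁,K₂τ₂)·Σ_{q∈S} c_q Ψ_{(K₁τ₁,K₂τ₂)}(q⁻¹)`, where the bumps in `K` read `θ(τ₁)θ(τ₂)`.
[cite: KowalskiMichelVanderKam2000, §6 p. 19, (21)–(23) p. 12 — derivation] -/
theorem sum_mul_fourier2_boxWeight_cell_eq_unitBox {l m d₁ d₂ : ℕ} (hl : 1 ≤ l) (hm : 1 ≤ m) (hd₁ : d₁ ∣ l)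
    (hd₂ : d₂ ∣ m) (r : ℕ) (i : ℕ × ℕ) (h₁ s : ℤ) (A : ℝ) (S : Finset ℕ) (hS : ∀ q ∈ S, q ≠ 0) (c : ℕ → ℂ) :
    ∑ q ∈ S, c q * fourier2 (boxWeight q d₁ d₂ (l / d₁) (m / d₂) (r + 1) i) ((h₁ : ℝ) / ((q * (r + 1) : ℕ) : ℝ))
        ((s : ℝ) / h₁ + A / ((h₁ : ℝ) * ((q * (r + 1) : ℕ) : ℝ))) =
      ((2 : ℝ) ^ i.1 * 2 ^ i.2 : ℝ) •
        ∫ τ₁, ∫ τ₂, (((dyadicBump τ₁ * dyadicBump τ₂ *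
            (((d₁ : ℝ) * (2 ^ i.1 * τ₁) * ((d₂ : ℝ) * (2 ^ i.2 * τ₂))) ^ (-(1 / 2 : ℝ)) * (((r + 1 : ℕ) : ℝ))⁻¹) : ℝ) : ℂ) *
              ker (2 ^ i.2 * τ₂) ((s : ℝ) / h₁)) *
          ∑ q ∈ S, c q *
            (((cutoffW ((4 * π ^ 2 * ((d₁ : ℝ) * (2 ^ i.1 * τ₁) * ((d₂ : ℝ) * (2 ^ i.2 * τ₂)))) * ((q : ℝ))⁻¹) : ℝ) : ℂ) *
              ((besselJ 1 ((4 * π * Real.sqrt (((l / d₁ : ℕ) : ℝ) * (2 ^ i.1 * τ₁) * (((m / d₂ : ℕ) : ℝ) * (2 ^ i.2 * τ₂))) /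
                  ((r + 1 : ℕ) : ℝ)) * ((q : ℝ))⁻¹) : ℝ) : ℂ) *
                Complex.exp (((-2 * π * ((2 ^ i.1 * τ₁) * ((h₁ : ℝ) / (r + 1)) + (2 ^ i.2 * τ₂) * (A / ((h₁ : ℝ) * (r + 1)))) *
                  ((q : ℝ))⁻¹ : ℝ) : ℂ) * I)) := by
  rw [sum_mul_fourier2_boxWeight_cell_eq hl hm hd₁ hd₂ r i h₁ s A S hS c,
    integral_integral_comp_mul_mul _ (by positivity : (0 : ℝ) < 2 ^ i.1) (by positivity : (0 : ℝ) < 2 ^ i.2)]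
  congr 1
  refine integral_congr_ae (Filter.Eventually.of_forall fun τ₁ => ?_)
  refine integral_congr_ae (Filter.Eventually.of_forall fun τ₂ => ?_)
  have h1 : (2 : ℝ) ^ i.1 * τ₁ / 2 ^ i.1 = τ₁ := by field_simp
  have h2 : (2 : ℝ) ^ i.2 * τ₂ / 2 ^ i.2 = τ₂ := by field_simp
  simp only [h1, h2]

end Summit.Parity.GeneralizedHardyLittlewood.Theorems.BeyondDiagonalBeatsQuarter.LevelSeparation

end
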